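import Mathlib.Analysis.Calculus.MeanValue
import Mathlib.Analysis.Calculus.ContDiff.Basic
import Mathlib.Analysis.Calculus.ContDiff.Bounds
import Mathlib.MeasureTheory.Integral.Bochner.Basic
import Mathlib.MeasureTheory.Integral.Bochner.Set
import Mathlib.MeasureTheory.Group.Measure
import Mathlib.Algebra.Group.ForwardDiff
import HarnessLib

/-!
# Iterated forward differences: algebra, zero-mean functions, and the smooth bound

Elementary calculus of the iterates `Δ_{w₁} ⋯ Δ_{w_q} φ` (`iterFwdDiff [w₁, …, w_q] φ`) of Mathlib's
forward difference `fwdDiff w φ (x) = φ (x + w) - φ x` (`Mathlib.Algebra.Group.ForwardDiff`, whose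
`fwdDiff_iter` lemmas treat a single repeated step) on an additive commutative group, written for
the proof of the basic estimate for cusp forms on Siegel sets of `GL_n`
(`Literature.NumberTheory.Automorphic.GLnCuspidalSpectrum.norm_smoothedForm_le_of_isSiegelSetGL`,
Garrett (2018), Thm. 7.3.10), where the cancellation of a smooth kernel against a cusp form along
the compact quotient `N(K) \ N(𝔸_K)` is organised as follows (a Poisson-summation-free form of
Garrett's argument, §7.3, PDF pp. 336–342):

* `norm_apply_le_of_forall_norm_iterFwdDiff_le` — **a zero-mean function is controlled by its
  iterated differences**: if `h` integrates to `0` over every translate `v + 𝓕` of a set `𝓕` of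
  finite positive measure for a translation-invariant measure (e.g. a periodic function with
  vanishing mean over every fundamental domain — a constant term), and all `q`-fold differences
  `Δ_{w₁} ⋯ Δ_{w_q} h (0)` with steps `wᵢ ∈ 𝓕` are bounded by `M`, then `‖h 0‖ ≤ M`
  (induction on `q`: `Δ_w` preserves the class, and `h(0) · ν(𝓕) = -∫_𝓕 (h - h 0)`).
* `norm_iterFwdDiff_le_of_contDiff` — **the smooth bound**: for `φ` of class `C^q` on a real normed
  space with `‖D^q φ‖ ≤ B` everywhere, `‖Δ_{w₁} ⋯ Δ_{w_q} φ (x)‖ ≤ B · ∏ ‖wᵢ‖` (mean value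
  inequality and `D(Δ φ) = Δ(D φ)`, by induction).
* bookkeeping: commutation of differences with each other, with additive maps
  (`iterFwdDiff_comp_addMonoidHom`), with integration against a kernel (`iterFwdDiff_integral`),
  invariance under steps congruent modulo a subgroup of periods (`iterFwdDiff_eq_of_forall₂`), and
  a vanishing criterion (`iterFwdDiff_eq_zero_of_forall_sublist`).

The multi-step list iterate `iterFwdDiff` is distinct from the tree's
`Literature.Analysis.Complex.FiniteDifference.iterFwdDiff` (a `Finset`-of-coordinates object on `ℂⁿ`)
and from Mathlib's single-step `fwdDiff_iter`. Everything here is elementary and proved (Mathlib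
only); we know no source stating these lemmas in this form, so they are tagged folklore (cf. the
finite-difference calculus, e.g. Jordan, *Calculus of Finite Differences* (1965), §§1–6).
-/

noncomputable section

open MeasureTheory Set Filter
open scoped Topology Pointwise ContDiff

namespace Literature.Analysis.Calculus

/-! ### Forward differences on an additive commutative group -/

section Algebra

variable {V : Type*} [AddCommGroup V] {E : Type*} [AddCommGroup E]

/-- `fwdDiff w φ x = φ (x + w) - φ x` (Mathlib's definition, unfolded). [folklore] -/
theorem fwdDiff_apply' (w : V) (φ : V → E) (x : V) : fwdDiff w φ x = φ (x + w) - φ x := rfl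

/-- **Iterated forward differences** `iterFwdDiff [w₁, …, w_q] φ = Δ_{w₁} (Δ_{w₂} (⋯ (Δ_{w_q} φ)))`
with `Δ_w = fwdDiff w` (Mathlib). A list version with independent steps (Mathlib's `fwdDiff_iter`
lemmas treat a single repeated step; `Literature.Analysis.Complex.FiniteDifference.iterDiff` is a
different object). [folklore] -/
def iterFwdDiff : List V → (V → E) → (V → E)
  | [], φ => φ
  | w :: l, φ => fwdDiff w (iterFwdDiff l φ)

/-- `iterFwdDiff [] φ = φ`. [folklore] -/
@[simp]
theorem iterFwdDiff_nil (φ : V → E) : iterFwdDiff [] φ = φ := rfl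

/-- `iterFwdDiff (w :: l) φ = Δ_w (iterFwdDiff l φ)`. [folklore] -/
@[simp]
theorem iterFwdDiff_cons (w : V) (l : List V) (φ : V → E) :
    iterFwdDiff (w :: l) φ = fwdDiff w (iterFwdDiff l φ) := rfl

/-- Forward differences commute: `Δ_v Δ_w = Δ_w Δ_v`. [folklore] -/
theorem fwdDiff_comm (v w : V) (φ : V → E) : fwdDiff v (fwdDiff w φ) = fwdDiff w (fwdDiff v φ) := by
  funext x
  simp only [fwdDiff_apply']
  rw [add_right_comm x v w]
  abel

/-- A single difference commutes with iterated differences. [folklore] -/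
theorem iterFwdDiff_fwdDiff (l : List V) (w : V) (φ : V → E) :
    iterFwdDiff l (fwdDiff w φ) = fwdDiff w (iterFwdDiff l φ) := by
  induction l with
  | nil => rfl
  | cons v l ih => rw [iterFwdDiff_cons, iterFwdDiff_cons, ih, fwdDiff_comm]

/-- Peeling off the innermost difference: `iterFwdDiff (l ++ [w]) φ = iterFwdDiff l (Δ_w φ)`. [folklore] -/
theorem iterFwdDiff_append_singleton (l : List V) (w : V) (φ : V → E) :
    iterFwdDiff (l ++ [w]) φ = iterFwdDiff l (fwdDiff w φ) := by
  induction l with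
  | nil => rfl
  | cons v l ih => rw [List.cons_append, iterFwdDiff_cons, iterFwdDiff_cons, ih]

/-- Differences are compatible with subtraction of functions. [folklore] -/
theorem fwdDiff_sub' (w : V) (φ ψ : V → E) : fwdDiff w (φ - ψ) = fwdDiff w φ - fwdDiff w ψ := by
  funext x; simp only [fwdDiff_apply', Pi.sub_apply]; abel

/-- **Differences along an additive map**: `iterFwdDiff l (φ ∘ L) x = iterFwdDiff (l.map L) φ (L x)` for
an additive homomorphism `L`. [folklore] -/
theorem iterFwdDiff_comp_addMonoidHom {W : Type*} [AddCommGroup W] (L : V →+ W) (φ : W → E)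
    (l : List V) (x : V) : iterFwdDiff l (φ ∘ L) x = iterFwdDiff (l.map L) φ (L x) := by
  induction l generalizing x with
  | nil => rfl
  | cons w l ih =>
    rw [List.map_cons, iterFwdDiff_cons, iterFwdDiff_cons, fwdDiff_apply', fwdDiff_apply', ih, ih, map_add]

/-- A function invariant under translation by a subgroup `P` of periods has `P`-invariant iterated
differences. [folklore] -/
theorem iterFwdDiff_add_of_forall (P : AddSubgroup V) {φ : V → E}
    (hφ : ∀ p ∈ P, ∀ x, φ (x + p) = φ x) (l : List V) :
    ∀ p ∈ P, ∀ x, iterFwdDiff l φ (x + p) = iterFwdDiff l φ x := by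
  induction l with
  | nil => exact hφ
  | cons w l ih =>
    intro p hp x
    rw [iterFwdDiff_cons, fwdDiff_apply', fwdDiff_apply', add_right_comm, ih p hp, ih p hp]

/-- **Steps congruent modulo periods give the same differences**: if `φ` is invariant under
translation by the subgroup `P` and `wᵢ - wᵢ' ∈ P` for all `i`, then
`Δ_{w₁} ⋯ Δ_{w_q} φ = Δ_{w₁'} ⋯ Δ_{w_q'} φ`. [folklore] -/
theorem iterFwdDiff_eq_of_forall₂ (P : AddSubgroup V) {φ : V → E}
    (hφ : ∀ p ∈ P, ∀ x, φ (x + p) = φ x) {l l' : List V}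
    (h : List.Forall₂ (fun w w' => w - w' ∈ P) l l') : iterFwdDiff l φ = iterFwdDiff l' φ := by
  induction h with
  | nil => rfl
  | @cons w w' l l' hww' _ ih =>
    rw [iterFwdDiff_cons, iterFwdDiff_cons, ih]
    funext x
    rw [fwdDiff_apply', fwdDiff_apply']
    have : x + w = x + w' + (w - w') := by abel
    rw [this, iterFwdDiff_add_of_forall P hφ l' (w - w') hww']

/-- **Vanishing criterion**: if `φ (x + s.sum) = 0` for every sublist `s` of `l`, then
`iterFwdDiff l φ x = 0` (each iterated difference is a signed sum of such values). [folklore] -/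
theorem iterFwdDiff_eq_zero_of_forall_sublist {φ : V → E} {l : List V} {x : V}
    (h : ∀ s : List V, s.Sublist l → φ (x + s.sum) = 0) : iterFwdDiff l φ x = 0 := by
  induction l generalizing x with
  | nil => simpa using h [] (List.Sublist.refl _)
  | cons w l ih =>
    rw [iterFwdDiff_cons, fwdDiff_apply', ih, ih, sub_zero]
    · intro s hs
      exact h s (hs.trans (List.sublist_cons_self w l))
    · intro s hs
      have := h (w :: s) (hs.cons_cons w)
      rwa [List.sum_cons, ← add_assoc] at this

/-- Evaluation of (continuous-linear-map-valued) differences: differences commute with application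
to a vector. [folklore] -/
theorem iterFwdDiff_clm_apply {𝕜 F G : Type*} [NontriviallyNormedField 𝕜] [NormedAddCommGroup F]
    [NormedSpace 𝕜 F] [NormedAddCommGroup G] [NormedSpace 𝕜 G] (Φ : V → F →L[𝕜] G) (v : F)
    (l : List V) (x : V) : iterFwdDiff l Φ x v = iterFwdDiff l (fun y => Φ y v) x := by
  induction l generalizing x with
  | nil => rfl
  | cons w l ih =>
    rw [iterFwdDiff_cons, iterFwdDiff_cons, fwdDiff_apply', fwdDiff_apply', ← ih, ← ih]
    rfl

end Algebra

/-! ### Differences and integration against a kernel -/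

section Integral

variable {V : Type*} [AddCommGroup V] {G : Type*} [MeasurableSpace G] {ν : Measure G}
  {E : Type*} [NormedAddCommGroup E] [NormedSpace ℝ E]

/-- **Differences commute with integration against a kernel**: if `g ↦ Φ y g` is integrable for
every `y`, then so is `g ↦ iterFwdDiff l (Φ · g) y`, and
`iterFwdDiff l (y ↦ ∫ Φ y g dν) x = ∫ iterFwdDiff l (y ↦ Φ y g) x dν(g)`. [folklore] -/
theorem iterFwdDiff_integral (Φ : V → G → E) (hΦ : ∀ y, Integrable (Φ y) ν) (l : List V) :
    (∀ x, Integrable (fun g => iterFwdDiff l (fun y => Φ y g) x) ν) ∧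
      ∀ x, iterFwdDiff l (fun y => ∫ g, Φ y g ∂ν) x = ∫ g, iterFwdDiff l (fun y => Φ y g) x ∂ν := by
  induction l with
  | nil => exact ⟨hΦ, fun x => rfl⟩
  | cons w l ih =>
    obtain ⟨hint, heq⟩ := ih
    refine ⟨fun x => ?_, fun x => ?_⟩
    · simp only [iterFwdDiff_cons, fwdDiff_apply']
      exact (hint (x + w)).sub (hint x)
    · simp only [iterFwdDiff_cons, fwdDiff_apply']
      rw [heq, heq, ← integral_sub (hint (x + w)) (hint x)]

end Integral

/-! ### Zero-mean functions are controlled by their iterated differences -/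

section ZeroMean

variable {V : Type*} [AddCommGroup V] [MeasurableSpace V] [MeasurableAdd V]
  {E : Type*} [NormedAddCommGroup E] [NormedSpace ℝ E]

/-- `h` has **zero mean on every translate of `𝓕`**: `h` is integrable on `v + 𝓕` with
`∫_{v + 𝓕} h dν = 0` for every `v` (the situation of a continuous periodic function whose mean over
every fundamental domain — a constant term — vanishes, `𝓕` a relatively compact fundamental domain).
[folklore] -/
def IsZeroMeanOnTranslates (ν : Measure V) (𝓕 : Set V) (h : V → E) : Prop :=
  ∀ v : V, IntegrableOn h (v +ᵥ 𝓕) ν ∧ ∫ x in v +ᵥ 𝓕, h x ∂ν = 0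

variable {ν : Measure V} [ν.IsAddRightInvariant] {𝓕 : Set V}

omit [MeasurableAdd V] [ν.IsAddRightInvariant] in
/-- A zero-mean function is integrable on `𝓕` itself. [folklore] -/
theorem IsZeroMeanOnTranslates.integrableOn {h : V → E} (hh : IsZeroMeanOnTranslates ν 𝓕 h) :
    IntegrableOn h 𝓕 ν := by
  simpa using (hh 0).1

omit [MeasurableAdd V] [ν.IsAddRightInvariant] in
/-- A zero-mean function has integral `0` over `𝓕` itself. [folklore] -/
theorem IsZeroMeanOnTranslates.setIntegral_eq_zero {h : V → E}
    (hh : IsZeroMeanOnTranslates ν 𝓕 h) : ∫ x in 𝓕, h x ∂ν = 0 := by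
  simpa using (hh 0).2

/-- Translating the variable: `∫_{v + 𝓕} h (x + w) dν(x) = ∫_{(v + w) + 𝓕} h dν` and the
corresponding integrability, for a right-translation-invariant measure. [folklore] -/
theorem integrableOn_comp_add_right_iff (h : V → E) (v w : V) :
    (IntegrableOn (fun x => h (x + w)) (v +ᵥ 𝓕) ν ↔ IntegrableOn h ((v + w) +ᵥ 𝓕) ν) ∧
      ∫ x in v +ᵥ 𝓕, h (x + w) ∂ν = ∫ x in (v + w) +ᵥ 𝓕, h x ∂ν := by
  have hmp : MeasurePreserving (fun x : V => x + w) ν ν := measurePreserving_add_right ν w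
  have hme : MeasurableEmbedding fun x : V => x + w := (MeasurableEquiv.addRight w).measurableEmbedding
  have hpre : (fun x : V => x + w) ⁻¹' ((v + w) +ᵥ 𝓕) = v +ᵥ 𝓕 := by
    ext x
    simp only [mem_preimage, Set.mem_vadd_set, vadd_eq_add]
    constructor
    · rintro ⟨y, hy, hyx⟩
      exact ⟨y, hy, by rw [add_right_comm] at hyx; exact add_right_cancel hyx⟩
    · rintro ⟨y, hy, rfl⟩
      exact ⟨y, hy, by rw [add_right_comm]⟩
  constructor
  · rw [← hpre]
    exact hmp.integrableOn_comp_preimage hme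
  · rw [← hpre]
    exact hmp.setIntegral_preimage_emb hme h _

/-- **The class of zero-mean functions is stable under forward differences.** [folklore] -/
theorem IsZeroMeanOnTranslates.fwdDiff {h : V → E} (hh : IsZeroMeanOnTranslates ν 𝓕 h) (w : V) :
    IsZeroMeanOnTranslates ν 𝓕 (fwdDiff w h) := by
  intro v
  obtain ⟨h1, h2⟩ := integrableOn_comp_add_right_iff (ν := ν) (𝓕 := 𝓕) h v w
  have hA : IntegrableOn (fun x => h (x + w)) (v +ᵥ 𝓕) ν := h1.2 (hh (v + w)).1
  have hB : IntegrableOn h (v +ᵥ 𝓕) ν := (hh v).1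
  refine ⟨hA.sub hB, ?_⟩
  change ∫ x in v +ᵥ 𝓕, h (x + w) - h x ∂ν = 0
  rw [integral_sub hA hB, h2, (hh (v + w)).2, (hh v).2, sub_zero]

/-- **A zero-mean function is controlled by its iterated differences.** Let `ν` be a
right-translation-invariant measure, `𝓕` a set with `0 < ν 𝓕 < ∞`, and `h` a function with zero
mean on every translate of `𝓕`. If all `q`-fold forward differences `Δ_{w₁} ⋯ Δ_{w_q} h (0)` with
steps `wᵢ ∈ 𝓕` have norm at most `M`, then `‖h 0‖ ≤ M`. (Induction on `q`: the differences `Δ_w h`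
are again zero-mean, and `‖h 0‖ · ν(𝓕) = ‖∫_𝓕 (h x - h 0) dν‖ ≤ sup_{w ∈ 𝓕} ‖h w - h 0‖ · ν(𝓕)`.)
This is the mechanism by which the vanishing of a constant term is converted into decay: the
differences are those of a smooth, slowly varying kernel. [folklore] -/
theorem norm_apply_le_of_forall_norm_iterFwdDiff_le [CompleteSpace E] (h𝓕0 : ν 𝓕 ≠ 0)
    (h𝓕 : ν 𝓕 ≠ ⊤) (q : ℕ) :
    ∀ {h : V → E}, IsZeroMeanOnTranslates ν 𝓕 h → ∀ {M : ℝ},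
      (∀ l : List V, l.length = q → (∀ w ∈ l, w ∈ 𝓕) → ‖iterFwdDiff l h 0‖ ≤ M) → ‖h 0‖ ≤ M := by
  induction q with
  | zero =>
    intro h _ M hM
    simpa using hM [] rfl (by simp)
  | succ q ih =>
    intro h hh M hM
    -- every single difference with step in `𝓕` is bounded by `M` at `0`
    have hstep : ∀ w ∈ 𝓕, ‖h w - h 0‖ ≤ M := by
      intro w hw
      have h1 : ‖fwdDiff w h 0‖ ≤ M := by
        refine ih (hh.fwdDiff w) fun l hl hlF => ?_
        rw [← iterFwdDiff_append_singleton]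
        refine hM (l ++ [w]) (by simp [hl]) fun v hv => ?_
        rcases List.mem_append.1 hv with hv | hv
        · exact hlF v hv
        · rw [List.mem_singleton.1 hv]; exact hw
      simpa [fwdDiff_apply'] using h1
    -- integrate `h 0 = -(h x - h 0) + h x` over `𝓕`
    have hpos : 0 < (ν 𝓕).toReal := ENNReal.toReal_pos h𝓕0 h𝓕
    have hlt : ν 𝓕 < ⊤ := h𝓕.lt_top
    have hint : IntegrableOn h 𝓕 ν := hh.integrableOn
    have hzero : ∫ x in 𝓕, h x ∂ν = 0 := hh.setIntegral_eq_zero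
    have hconst : ∫ _ in 𝓕, h 0 ∂ν = (ν 𝓕).toReal • h 0 := by
      rw [setIntegral_const]
      rfl
    have hc : IntegrableOn (fun _ : V => h 0) 𝓕 ν := integrableOn_const (hs := h𝓕)
    have hdiff : ∫ x in 𝓕, (h 0 - h x) ∂ν = (ν 𝓕).toReal • h 0 := by
      rw [integral_sub hc hint, hzero, sub_zero, hconst]
    have hbound : ‖∫ x in 𝓕, (h 0 - h x) ∂ν‖ ≤ M * (ν 𝓕).toReal := by
      refine norm_setIntegral_le_of_norm_le_const hlt fun x hx => ?_
      rw [norm_sub_rev]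
      exact hstep x hx
    rw [hdiff, norm_smul, Real.norm_of_nonneg hpos.le] at hbound
    nlinarith

end ZeroMean

/-! ### The smooth bound -/

section Smooth

variable {F : Type*} [NormedAddCommGroup F] [NormedSpace ℝ F]
  {E : Type*} [NormedAddCommGroup E] [NormedSpace ℝ E]

/-- Iterated differences of a differentiable function are differentiable. [folklore] -/
theorem differentiable_iterFwdDiff {φ : F → E} (hφ : Differentiable ℝ φ) (l : List F) :
    Differentiable ℝ (iterFwdDiff l φ) := by
  induction l with
  | nil => exact hφ
  | cons w l ih =>
    rw [iterFwdDiff_cons]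
    exact (ih.comp (differentiable_id.add_const w)).sub ih

/-- **Differentiation commutes with differences**: `D (Δ_{w₁} ⋯ Δ_{w_q} φ) = Δ_{w₁} ⋯ Δ_{w_q} (D φ)`
for differentiable `φ`. [folklore] -/
theorem fderiv_iterFwdDiff {φ : F → E} (hφ : Differentiable ℝ φ) (l : List F) (x : F) :
    fderiv ℝ (iterFwdDiff l φ) x = iterFwdDiff l (fderiv ℝ φ) x := by
  induction l generalizing x with
  | nil => rfl
  | cons w l ih =>
    have hd : Differentiable ℝ (iterFwdDiff l φ) := differentiable_iterFwdDiff hφ l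
    rw [iterFwdDiff_cons, iterFwdDiff_cons, fwdDiff_apply']
    change fderiv ℝ (fun y => iterFwdDiff l φ (y + w) - iterFwdDiff l φ y) x = _
    have h1 : DifferentiableAt ℝ (fun y => iterFwdDiff l φ (y + w)) x :=
      (hd (x + w)).comp x (differentiableAt_id.add_const w)
    rw [fderiv_fun_sub h1 (hd x), fderiv_comp_add_right, ih, ih]

/-- **The smooth bound for iterated differences.** If `φ` is of class `C^q` (`q = l.length`) on a
real normed space and `‖D^q φ (x)‖ ≤ B` for all `x`, then
`‖Δ_{w₁} ⋯ Δ_{w_q} φ (x)‖ ≤ B · ‖w₁‖ ⋯ ‖w_q‖`. Proof by induction: by the mean value inequality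
`‖Δ_w ψ (x)‖ ≤ sup ‖D ψ‖ · ‖w‖` for `ψ = Δ_{w₂} ⋯ Δ_{w_q} φ`, and `D ψ · v = Δ_{w₂} ⋯ Δ_{w_q} (D φ · v)`
with `‖D^{q-1} (D φ · v)‖ ≤ B ‖v‖`. [folklore] -/
theorem norm_iterFwdDiff_le_of_contDiff :
    ∀ (l : List F) {φ : F → E}, ContDiff ℝ l.length φ → ∀ {B : ℝ},
      (∀ x, ‖iteratedFDeriv ℝ l.length φ x‖ ≤ B) → ∀ x : F,
        ‖iterFwdDiff l φ x‖ ≤ B * (l.map (‖·‖)).prod := by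
  intro l
  induction l with
  | nil =>
    intro φ _ B hB x
    simpa using hB x
  | cons w l ih =>
    intro φ hφ B hB x
    rw [List.length_cons] at hφ hB
    have h1 : ContDiff ℝ 1 φ := hφ.of_le (by exact_mod_cast Nat.le_add_left 1 l.length)
    have hd : Differentiable ℝ φ := h1.differentiable one_ne_zero
    have hB0 : 0 ≤ B := le_trans (norm_nonneg _) (hB x)
    -- the directional derivatives `D φ · v` are `C^{q-1}` with `‖D^{q-1}‖ ≤ B ‖v‖`
    have hderiv : ∀ v : F, ContDiff ℝ l.length (fun y => fderiv ℝ φ y v) ∧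
        ∀ y, ‖iteratedFDeriv ℝ l.length (fun y => fderiv ℝ φ y v) y‖ ≤ B * ‖v‖ := by
      intro v
      have hf : ContDiff ℝ l.length (fderiv ℝ φ) :=
        hφ.fderiv_right (m := l.length) (by exact_mod_cast le_rfl)
      refine ⟨hf.clm_apply contDiff_const, fun y => ?_⟩
      have heq : (fun y => fderiv ℝ φ y v) =
          (ContinuousLinearMap.apply ℝ E v) ∘ (fderiv ℝ φ) := by
        funext y; rfl
      rw [heq, ContinuousLinearMap.iteratedFDeriv_comp_left _ hf.contDiffAt
        (by exact_mod_cast le_rfl)]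
      calc ‖(ContinuousLinearMap.apply ℝ E v).compContinuousMultilinearMap
              (iteratedFDeriv ℝ l.length (fderiv ℝ φ) y)‖
          ≤ ‖ContinuousLinearMap.apply ℝ E v‖ * ‖iteratedFDeriv ℝ l.length (fderiv ℝ φ) y‖ :=
            ContinuousLinearMap.norm_compContinuousMultilinearMap_le _ _
        _ ≤ ‖v‖ * B := by
            have hav : ‖ContinuousLinearMap.apply ℝ E v‖ ≤ ‖v‖ :=
              ContinuousLinearMap.opNorm_le_bound _ (norm_nonneg v) fun f => by
                rw [ContinuousLinearMap.apply_apply, mul_comm]; exact f.le_opNorm v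
            refine mul_le_mul hav ?_ (norm_nonneg _) (norm_nonneg _)
            rw [norm_iteratedFDeriv_fderiv]
            exact hB y
        _ = B * ‖v‖ := mul_comm _ _
    -- bound on the operator norm of `D (iterFwdDiff l φ)`
    set ψ := iterFwdDiff l φ with hψ
    have hψd : Differentiable ℝ ψ := differentiable_iterFwdDiff hd l
    have hop : ∀ y, ‖fderiv ℝ ψ y‖ ≤ B * (l.map (‖·‖)).prod := by
      intro y
      refine ContinuousLinearMap.opNorm_le_bound _ (mul_nonneg hB0 ?_) fun v => ?_
      · exact List.prod_nonneg fun a ha => by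
          obtain ⟨b, -, rfl⟩ := List.mem_map.1 ha; exact norm_nonneg _
      rw [hψ, fderiv_iterFwdDiff hd l y, iterFwdDiff_clm_apply]
      calc ‖iterFwdDiff l (fun y => fderiv ℝ φ y v) y‖ ≤ B * ‖v‖ * (l.map (‖·‖)).prod :=
            ih (hderiv v).1 (hderiv v).2 y
        _ = B * (l.map (‖·‖)).prod * ‖v‖ := by ring
    -- mean value inequality on the segment `[x, x + w]`
    have hmvt : ‖ψ (x + w) - ψ x‖ ≤ B * (l.map (‖·‖)).prod * ‖x + w - x‖ :=
      convex_univ.norm_image_sub_le_of_norm_fderiv_le (fun y _ => hψd y) (fun y _ => hop y)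
        (mem_univ x) (mem_univ (x + w))
    rw [add_sub_cancel_left] at hmvt
    rw [iterFwdDiff_cons, fwdDiff_apply', List.map_cons, List.prod_cons]
    calc ‖ψ (x + w) - ψ x‖ ≤ B * (l.map (‖·‖)).prod * ‖w‖ := hmvt
      _ = B * (‖w‖ * (l.map (‖·‖)).prod) := by ring

/-- The smooth bound for `C^∞` functions: `‖Δ_{w₁} ⋯ Δ_{w_q} φ (x)‖ ≤ (sup ‖D^q φ‖) · ∏ ‖wᵢ‖`.
[folklore] -/
theorem norm_iterFwdDiff_le_of_contDiff_infty {φ : F → E} (hφ : ContDiff ℝ ∞ φ) (l : List F)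
    {B : ℝ} (hB : ∀ x, ‖iteratedFDeriv ℝ l.length φ x‖ ≤ B) (x : F) :
    ‖iterFwdDiff l φ x‖ ≤ B * (l.map (‖·‖)).prod :=
  norm_iterFwdDiff_le_of_contDiff l (hφ.of_le (by exact_mod_cast le_top)) hB x

end Smooth

end Literature.Analysis.Calculus
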